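import Summits.AtomisticToContinuum.Crystallization.Theorems.FreeSplittingCertificatesStrictSplittingRuleCoreJointDefs
import Summits.AtomisticToContinuum.Crystallization.Theorems.FreeSplittingCertificatesStrictSplittingRuleFiniteBall

/-!
# Existence of the least-squares infinitesimal rotation of a first shell

Helper of reshape r6 (lead c5) of crux `StrictSplittingRule` (stmt-AtomisticToContinuum-12560), line `registered`:
toward any proof of H12⋆ `CoreJointCoercive` (…CoreJointDefs.lean). Registered stub, landed `--supports stmt-AtomisticToContinuum-12560`.
-/

noncomputable section

namespace Summit.AtomisticToContinuum.Crystallization.Theorems.StrictSplittingRuleBirth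

open scoped BigOperators Classical
open Literature.MathematicalPhysics.StatisticalMechanics
open Literature.Geometry.DiscreteGeometry
open Summit.AtomisticToContinuum.Crystallization.Theorems.PalmUnimodularRigidity.LayeredLawsSelectHcp
  (hcpSite ljSqDeriv)

/-- A `tsum` of a function that vanishes off a finite set `{q | P q}` is the finite sum over that set. [folklore] -/
private theorem lsRot_tsum_ite_eq_sum {α : Type*} {P : α → Prop} [DecidablePred P]
    (hS : Set.Finite {q | P q}) (g : α → ℝ) :
    (∑' q, if P q then g q else 0) = ∑ q ∈ hS.toFinset, g q := by
  rw [tsum_eq_sum (s := hS.toFinset) (f := fun q => if P q then g q else 0) fun q hq =>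
    if_neg fun hP : P q => hq (hS.mem_toFinset.2 hP)]
  exact Finset.sum_congr rfl fun q hq => if_pos (hS.mem_toFinset.1 hq)

/-- Finite-dimensional least squares over the skew maps: for finitely many pairs `(d q, e q)` in a
finite-dimensional real inner product space there is a skew linear map `W` (`⟪W z, z⟫ = 0`) minimising
`∑ q ∈ F, ‖e q - W (d q)‖²` among all skew linear maps (orthogonal projection, in the `ℓ²` space of
`F`-indexed families, onto the finite-dimensional subspace `{(W (d q))_q | W skew}`). [folklore] -/
private theorem lsRot_exists_min {α E : Type*} [NormedAddCommGroup E] [InnerProductSpace ℝ E]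
    [FiniteDimensional ℝ E] (F : Finset α) (d e : α → E) :
    ∃ W : E →ₗ[ℝ] E, (∀ z : E, inner ℝ (W z) z = 0) ∧
      ∀ W' : E →ₗ[ℝ] E, (∀ z : E, inner ℝ (W' z) z = 0) →
        ∑ q ∈ F, ‖e q - W (d q)‖ ^ 2 ≤ ∑ q ∈ F, ‖e q - W' (d q)‖ ^ 2 := by
  -- the `ℓ²` space of `F`-indexed families in `E`, the data vector and the subspace of skew fits
  let v : PiLp 2 (fun _ : F => E) := WithLp.toLp 2 fun i : F => e i.1
  let L : Submodule ℝ (PiLp 2 (fun _ : F => E)) :=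
    { carrier := {w | ∃ W : E →ₗ[ℝ] E, (∀ z : E, inner ℝ (W z) z = 0) ∧ ∀ i : F, w i = W (d i.1)}
      add_mem' := by
        rintro w₁ w₂ ⟨W₁, hW₁, h₁⟩ ⟨W₂, hW₂, h₂⟩
        refine ⟨W₁ + W₂, fun z => ?_, fun i => ?_⟩
        · rw [LinearMap.add_apply, inner_add_left, hW₁, hW₂, add_zero]
        · rw [PiLp.add_apply, LinearMap.add_apply, h₁, h₂]
      zero_mem' := ⟨0, fun z => by rw [LinearMap.zero_apply, inner_zero_left],
        fun i => by rw [PiLp.zero_apply, LinearMap.zero_apply]⟩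
      smul_mem' := by
        rintro c w ⟨W, hW, hw⟩
        refine ⟨c • W, fun z => ?_, fun i => ?_⟩
        · rw [LinearMap.smul_apply, real_inner_smul_left, hW, mul_zero]
        · rw [PiLp.smul_apply, LinearMap.smul_apply, hw] }
  -- the finite sum is the squared `ℓ²` distance from `v` to the corresponding point of `L`
  have key : ∀ (W : E →ₗ[ℝ] E) (w : PiLp 2 (fun _ : F => E)), (∀ i : F, w i = W (d i.1)) →
      ∑ q ∈ F, ‖e q - W (d q)‖ ^ 2 = ‖v - w‖ ^ 2 := by
    intro W w hw
    rw [PiLp.norm_sq_eq_of_L2, ← Finset.sum_coe_sort]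
    refine Finset.sum_congr rfl fun i _ => ?_
    rw [PiLp.sub_apply, hw]
  -- `L` is finite-dimensional, hence complete: a nearest point of `L` to `v` exists
  obtain ⟨w₀, hw₀, hmin⟩ := L.exists_norm_eq_iInf_of_complete_subspace L.complete_of_finiteDimensional v
  obtain ⟨W, hW, hWw⟩ := hw₀
  refine ⟨W, hW, fun W' hW' => ?_⟩
  let w' : PiLp 2 (fun _ : F => E) := WithLp.toLp 2 fun i : F => W' (d i.1)
  have hw'L : w' ∈ L := ⟨W', hW', fun i => rfl⟩
  have hbdd : BddBelow (Set.range fun w : (L : Set (PiLp 2 (fun _ : F => E))) => ‖v - w‖) :=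
    ⟨0, Set.forall_mem_range.2 fun _ => norm_nonneg _⟩
  have hle : ‖v - w₀‖ ≤ ‖v - w'‖ := by
    have hc := ciInf_le hbdd ⟨w', hw'L⟩
    rw [← hmin] at hc
    exact hc
  rw [key W w₀ hWw, key W' w' fun i => rfl]
  exact pow_le_pow_left₀ (norm_nonneg _) hle 2

/-- **stub_leastSquaresRotationExists** (r6 helper, chart): for every displacement field `u` and site `p` there is a skew
linear map `W` (an infinitesimal rotation) that best fits the relative displacements of `p`'s first shell — the
least-squares clause of `CoreJointSiteIneq`.  (The shell sum is finite: `stub_finiteBall`; the set of fields `(W(y_q−y_p))_q`,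
`W` skew, is a finite-dimensional subspace, so the orthogonal projection gives a minimiser.) [folklore] -/
theorem stub_leastSquaresRotationExists : ∀ a h : ℝ, 0 < a → 0 < h →
    ∀ (u : ℤ × ℤ × ℤ → EuclideanSpace ℝ (Fin 3)) (p : ℤ × ℤ × ℤ),
      ∃ W : EuclideanSpace ℝ (Fin 3) →ₗ[ℝ] EuclideanSpace ℝ (Fin 3),
        (∀ z : EuclideanSpace ℝ (Fin 3), inner ℝ (W z) z = 0) ∧
        ∀ W' : EuclideanSpace ℝ (Fin 3) →ₗ[ℝ] EuclideanSpace ℝ (Fin 3),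
          (∀ z : EuclideanSpace ℝ (Fin 3), inner ℝ (W' z) z = 0) →
          (∑' q : ℤ × ℤ × ℤ,
              (if 0 < ‖hcpSite a h q - hcpSite a h p‖ ∧ ‖hcpSite a h q - hcpSite a h p‖ ≤ 11 / 10 * a then
                ‖u q - u p - W (hcpSite a h q - hcpSite a h p)‖ ^ 2 else (0 : ℝ))) ≤
          (∑' q : ℤ × ℤ × ℤ,
              (if 0 < ‖hcpSite a h q - hcpSite a h p‖ ∧ ‖hcpSite a h q - hcpSite a h p‖ ≤ 11 / 10 * a then
                ‖u q - u p - W' (hcpSite a h q - hcpSite a h p)‖ ^ 2 else (0 : ℝ))) := by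
  intro a h ha hh u p
  -- the first shell of `p` is a finite index set (`stub_finiteBall`)
  have hS : Set.Finite {q : ℤ × ℤ × ℤ | 0 < ‖hcpSite a h q - hcpSite a h p‖ ∧
      ‖hcpSite a h q - hcpSite a h p‖ ≤ 11 / 10 * a} :=
    (stub_finiteBall a h ha hh p (11 / 10 * a)).subset fun q hq => hq.2
  obtain ⟨W, hW, hmin⟩ := lsRot_exists_min hS.toFinset (fun q => hcpSite a h q - hcpSite a h p)
    fun q => u q - u p
  refine ⟨W, hW, fun W' hW' => ?_⟩
  rw [lsRot_tsum_ite_eq_sum hS, lsRot_tsum_ite_eq_sum hS]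
  exact hmin W' hW'

end Summit.AtomisticToContinuum.Crystallization.Theorems.StrictSplittingRuleBirth

end
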